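import Mathlib
import HarnessLib
import Literature.MathematicalPhysics.StatisticalMechanics.PolymerProductABKM
import Literature.MathematicalPhysics.StatisticalMechanics.StepKernelBoundsABKM
import Literature.MathematicalPhysics.StatisticalMechanics.RenormalisationStepAlgebra

/-!
# Integrability of `ξ ↦ e^{−H(Z, φ+ξ)} K(Y, φ+ξ)` for disjoint polymers — the Fubini hypothesis of
# Proposition 6.6 along the flow ([ABKM19] Lemma 8.3, Lemma 8.4, Lemma 9.3, Theorem 7.1 (w5))

Proposition 6.6 of [ABKM19] (`RenormalisationStepDisjoint.rgStep_identity_of_disjoint`) turns the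
fluctuation integral of `(e^{−H_k} ∘ K_k)(Λ)` into `(e^{−H_{k+1}} ∘ K_{k+1})(Λ)` as soon as every
`ξ ↦ e^{−H(Z, φ+ξ)} K(Y, φ+ξ)` with DISJOINT `k`-polymers `Z, Y` is `μ_{k+1}`-integrable.  For
`(H, K)` in the domain of the renormalisation maps (`‖H‖_{k,0} ≤ ⅛`, `K` factorising with
`K(∅) = 1`, `C^{r₀}`, local and of finite weak norm) this integrability is a by-product of the norm
estimates: `e^{−H}` is bounded in the strong weights (Lemma 9.3, `tayNormLE_expNegH_strong_abkm`),
`K(Y)` in the weak weight `w_k^Y` (Lemma 8.3 (i), `tayNormLE_of_factorises`), the weights multiply up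
for disjoint supports ((w5), `weight_mul_prod_strongWeight_le`), and `w_k^{Z∪Y}(φ + ·)` is dominated
along gauge sections for every step kernel with `StepKernelBounds` (Lemma 8.4).

* **`tayNormLE_bprod_expNegH_mul_abkm`** — `|(e^{−H})^{Z} K(Y)|_{T_{Z∪Y}, w_k^{Z∪Y}} ≤
  (e^{1/4})^{|𝓑_k(Z)|} ∏_{Y'∈𝒞(Y)} C A^{−|Y'|_k}` for disjoint `k`-polymers `Z, Y`;
* **`integrable_expNegH_mul_of_stepKernelBounds`** — the Fubini hypothesis of
  `rgStep_identity_of_disjoint` for the torus data with step kernel by predicate.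

Everything is proved; no named fact.

## References
* S. Adams, S. Buchholz, R. Kotecký, S. Müller, arXiv:1910.13564, Lemma 8.3, Lemma 8.4, Lemma 9.3,
  Theorem 7.1 (w5), Proposition 6.6 [AdamsBuchholzKoteckyMuller2019].
-/

noncomputable section

namespace Literature.MathematicalPhysics.StatisticalMechanics.GradientRG

open scoped BigOperators Classical
open Finset Matrix MeasureTheory
open Literature.MathematicalPhysics.StatisticalMechanics.TorusPolymer
  (IsPolymer Separated blocks polys bprod blockOf thicken mem_polys mem_blocks isPolymer_blockOf
    isPolymer_empty)
open Literature.Barriers.CriticalPhenomena.LongRangePhi4.Polymer (IsConn components)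
open Literature.MathematicalPhysics.QuantumFieldTheory

variable {d M : ℕ} [NeZero M]

/-- **`|(e^{−H})^{Z} K(Y)|_{T_{Z∪Y}, w_k^{Z∪Y}} ≤ (e^{1/4})^{|𝓑_k(Z)|} ∏_{Y'∈𝒞(Y)} C A^{−|Y'|_k}`** for
DISJOINT `k`-polymers `Z, Y` (torus data; `‖H‖_{k,0} ≤ ⅛`, `K` factorising, `K(∅) = 1`, `C^{r₀}`,
local on connected polymers, `‖K‖_k^{(A)} ≤ C`).
[cite: AdamsBuchholzKoteckyMuller2019, Lemma 8.3 / Lemma 9.3 / Theorem 7.1 (w5)] -/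
theorem tayNormLE_bprod_expNegH_mul_abkm {L N Mord R n p r₀ : ℕ} {θbar lam μ δ₁ δ₀ A𝒫 h A : ℝ}
    {𝒞 : ℕ → (Fin d → ZMod M) → ℝ} (hd : 2 ≤ d) (hLodd : Odd L)
    (hM : M = L ^ N) {k : ℕ} (hkN : k ≤ N) (hp : d / 2 + 1 ≤ p) (hMord : d / 2 + 1 ≤ Mord)
    (hB : AbkmWeightBounds L N Mord R n θbar lam μ δ₁ δ₀ A𝒫 𝒞
      (abkmWeightData L N Mord R θbar (schedDelta δ₀ δ₁ N) 𝒞))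
    (hδ₀ : 0 < δ₀) (hδ₁ : 0 < δ₁) (hh : 0 < h) (hh0 : hZeroSq d R δ₀ δ₁ ≤ h ^ 2) (hA : 0 < A)
    {Z Y : Finset (Fin d → ZMod M)} (hZ : IsPolymer (L ^ k) Z) (hY : IsPolymer (L ^ k) Y)
    (hZY : Disjoint Z Y)
    {H : RelevantHamiltonian ℂ d}
    (hH : hamNorm (fieldWt h (L : ℝ) d k) ((L : ℝ) ^ k) (L ^ (d * k)) H ≤ 1 / 8)
    {K : Finset (Fin d → ZMod M) → ((Fin d → ZMod M) → ℝ) → ℂ} {C : ℝ} (hC : 0 ≤ C)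
    (hK : WeakNormLE (abkmNormParams L N Mord R p r₀ h θbar A (schedDelta δ₀ δ₁ N) 𝒞) k K C)
    (hKfac : Factorises (L ^ k) K) (hK0 : ∀ φ, K ∅ φ = 1) (hKd : ∀ Y, ContDiff ℝ r₀ (K Y))
    (hKloc : ∀ Y, IsPolymer (L ^ k) Y → IsConn Y →
      IsGaugeLocal ((abkmNormParams L N Mord R p r₀ h θbar A (schedDelta δ₀ δ₁ N) 𝒞).gauge k Y) (K Y)) :
    TayNormLE ((abkmNormParams L N Mord R p r₀ h θbar A (schedDelta δ₀ δ₁ N) 𝒞).gauge k (Z ∪ Y)) r₀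
      ((abkmWeightData L N Mord R θbar (schedDelta δ₀ δ₁ N) 𝒞).weight k (Z ∪ Y))
      (fun φ => bprod (L ^ k) (fun B => expNegH H B φ) Z * K Y φ)
      ((∏ _B ∈ blocks (L ^ k) Z, Real.exp (1 / 4)) *
        ∏ Y' ∈ components Y, C * (abkmNormParams L N Mord R p r₀ h θbar A (schedDelta δ₀ δ₁ N) 𝒞).aFactor k Y') := by
  set P := abkmNormParams L N Mord R p r₀ h θbar A (schedDelta δ₀ δ₁ N) 𝒞 with hP
  set W := abkmWeightData L N Mord R θbar (schedDelta δ₀ δ₁ N) 𝒞 with hW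
  set s := L ^ k with hs
  set X := Z ∪ Y with hXdef
  have hX : IsPolymer s X := hZ.union hY
  have hYX : Y ⊆ X := Finset.subset_union_right
  have hZX : Z ⊆ X := Finset.subset_union_left
  have hXY : X \ Y = Z := by
    rw [hXdef, Finset.union_sdiff_right, Finset.sdiff_eq_self_of_disjoint hZY]
  have hL0 : (0 : ℝ) < L := by exact_mod_cast hLodd.pos
  obtain ⟨t, ht⟩ : ∃ t, N = k + t := ⟨N - k, by omega⟩
  have hMt : M = s * L ^ t := by rw [hs, ← pow_add, ← ht]; exact hM
  have htodd : Odd (L ^ t) := hLodd.pow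
  have hsodd : Odd s := hLodd.pow
  have h𝔥 : 0 < P.𝔥 k := fieldWt_pos hh hL0 d k
  have hR : 0 < P.R k := by show (0 : ℝ) < (L : ℝ) ^ k; positivity
  -- strong family and (w5)
  set G : ℕ → Finset (Fin d → ZMod M) → Matrix (Fin d → ZMod M) (Fin d → ZMod M) ℝ :=
    fun j Y => strongCoef h N j • derivForm (L : ℝ) j (diffIndex d Mord)
      (boxDensity (boxRad R L j) (boxWt (L : ℝ) d j) Y) with hG
  have hGs : W.StrongDominated G fun _ X Y => Disjoint X Y :=
    hB.strong (diffIndex d Mord) (fun α hα => hα) (strongCoef h N) (strongCoef_le hδ₀ hδ₁ hh hh0)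
  have hgauge : ∀ Y' ⊆ X, ∀ ξ, ‖P.gauge k Y' ξ‖ ≤ ‖P.gauge k X ξ‖ := fun Y' hY' ξ =>
    norm_fieldGauge_mono_set _ _ _ (TorusPolymer.thicken_mono _ hY') ξ
  -- the block functional `e^{−H}`
  have hcard : ∀ x, (blockOf s x).card = L ^ (d * k) := fun x => by
    rw [TorusPolymer.card_blockOf hMt hsodd htodd x, hs, ← pow_mul, mul_comm]
  have hF : ∀ B ∈ blocks s Z, TayNormLE (P.gauge k B) r₀ (expWeight (G k B))
      (fun ψ => expNegH H B ψ) (Real.exp (1 / 4)) := by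
    intro B hBm
    obtain ⟨x, -, rfl⟩ := mem_blocks.1 hBm
    have hH' : hamNorm (fieldWt h (L : ℝ) d k) ((L : ℝ) ^ k) (blockOf s x).card H ≤ 1 / 8 := by
      rw [hcard x]; exact hH
    exact tayNormLE_expNegH_strong_abkm (R := R) (N := N) (Mord := Mord) hd hLodd hM hkN hh
      hMord hp (TorusPolymer.subset_thicken (P.rad k) (blockOf s x)) r₀ hH'
  have hFd : ∀ B ∈ blocks s Z, ContDiff ℝ r₀ (fun ψ : (Fin d → ZMod M) → ℝ => expNegH H B ψ) :=
    fun B _ => (contDiff_eval H B (n := r₀)).neg.cexp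
  have hFloc : ∀ B ∈ blocks s Z, IsGaugeLocal (P.gauge k B)
      (fun ψ : (Fin d → ZMod M) → ℝ => expNegH H B ψ) := fun B _ =>
    isGaugeLocal_cexp_neg_eval h𝔥.ne' hR.ne' hp (TorusPolymer.subset_thicken _ _) H
  have hleb : ∀ B ∈ blocks s Z, ∀ ξ, ‖P.gauge k B ξ‖ ≤ ‖P.gauge k X ξ‖ := fun B hBm =>
    hgauge B ((hZ.subset_of_mem_blocks hBm).trans hZX)
  have ha : ∀ B ∈ blocks s Z, (0 : ℝ) ≤ Real.exp (1 / 4) := fun _ _ => (Real.exp_pos _).le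
  have h1 := tayNormLE_bprod s (P.gauge k X) (fun B => P.gauge k B) Z hF hleb hFd hFloc ha
  have hprodCD : ContDiff ℝ r₀ (fun φ => bprod s (fun B => expNegH H B φ) Z) := by
    unfold TorusPolymer.bprod
    exact contDiff_prod fun B hB => hFd B hB
  have hprodloc : IsGaugeLocal (P.gauge k X) (fun φ => bprod s (fun B => expNegH H B φ) Z) := by
    unfold TorusPolymer.bprod
    exact IsGaugeLocal.prod _ fun B hB => (hFloc B hB).of_norm_le (hleb B hB)
  -- `K` on `Y`: Lemma 8.3 (i)
  have hwU : ∀ X' Y', IsPolymer s X' → IsPolymer s Y' → Separated (s + 1) X' Y' →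
      ∀ φ, W.weight k (X' ∪ Y') φ = W.weight k X' φ * W.weight k Y' φ := fun X' Y' _ _ hsep φ =>
    WeightData.weight_union hB.dominated hB.isLocal hB.additive (k := k) hsep φ
  have hw0 : ∀ φ, W.weight k ∅ φ = 1 := weight_empty_of_union hwU (fun φ => W.weight_pos k ∅ φ)
  have hMo : Odd M := by rw [hM]; exact hLodd.pow
  have hKY : TayNormLE (P.gauge k Y) r₀ (W.weight k Y) (K Y) (∏ Y' ∈ components Y, C * P.aFactor k Y') := by
    refine tayNormLE_of_factorises hMt hsodd htodd (P.gauge k Y) (fun Z => P.gauge k Z) hwU hw0 hKfac hK0 hY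
      (fun Y' hY' => ?_) (fun Y' hY' ξ => ?_) (fun Y' _ => hKd Y') (fun Y' hY' => ?_) (fun Y' _ => ?_)
    · obtain ⟨hYp, hYc⟩ := TorusPolymer.IsPolymer.of_mem_components hMo hsodd hY hY'
      exact hK Y' hYp hYc
    · have hY'Y : Y' ⊆ Y := by
        rw [Literature.Barriers.CriticalPhenomena.LongRangePhi4.Polymer.eq_biUnion_components Y]
        exact Finset.subset_biUnion_of_mem id hY'
      exact norm_fieldGauge_mono_set _ _ _ (TorusPolymer.thicken_mono _ hY'Y) ξ
    · obtain ⟨hYp, hYc⟩ := TorusPolymer.IsPolymer.of_mem_components hMo hsodd hY hY'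
      exact hKloc Y' hYp hYc
    · exact mul_nonneg hC (WeakNormLE.aFactor_pos hA k Y').le
  have hlep : ∀ ξ, ‖P.gauge k Y ξ‖ ≤ ‖P.gauge k X ξ‖ := hgauge Y hYX
  have hKlocY : IsGaugeLocal (P.gauge k Y) (K Y) := by
    have hpoly : ∀ Y' ∈ components Y, IsPolymer s Y' := fun Y' hY' =>
      (TorusPolymer.IsPolymer.of_mem_components hMo hsodd hY hY').1
    have hsep := TorusPolymer.pairwise_separated_components hMt hsodd htodd hY
    have hKeq : K Y = fun φ => ∏ Y' ∈ components Y, K Y' φ := by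
      funext φ
      conv_lhs => rw [Literature.Barriers.CriticalPhenomena.LongRangePhi4.Polymer.eq_biUnion_components Y]
      exact eq_prod_of_factorises hKfac hK0 _ hpoly hsep φ
    rw [hKeq]
    refine IsGaugeLocal.prod _ fun Y' hY' => ?_
    obtain ⟨hYp, hYc⟩ := TorusPolymer.IsPolymer.of_mem_components hMo hsodd hY hY'
    have hY'Y : Y' ⊆ Y := by
      rw [Literature.Barriers.CriticalPhenomena.LongRangePhi4.Polymer.eq_biUnion_components Y]
      exact Finset.subset_biUnion_of_mem id hY'
    exact (hKloc Y' hYp hYc).of_norm_le fun ξ => norm_fieldGauge_mono_set _ _ _ (TorusPolymer.thicken_mono _ hY'Y) ξ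
  have hc : (0 : ℝ) ≤ ∏ Y' ∈ components Y, C * P.aFactor k Y' :=
    Finset.prod_nonneg fun Y' _ => mul_nonneg hC (WeakNormLE.aFactor_pos hA k Y').le
  -- (w5)
  have hw : ∀ φ, (∏ B ∈ blocks s Z, expWeight (G k B) φ) * W.weight k Y φ ≤ W.weight k X φ := fun φ => by
    have h := weight_mul_prod_strongWeight_le hB.dominated hB.monotone hGs k s hX hY hYX φ
    rwa [hXY] at h
  exact TayNormLE.mul (T := P.gauge k X) (w := W.weight k X) h1 hKY (fun ξ => le_rfl) hlep hprodCD (hKd Y)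
    hprodloc hKlocY (Finset.prod_nonneg ha) hc hw

/-- **The Fubini hypothesis of Proposition 6.6 along the flow**: for the torus data, a step kernel
`𝒞q` with `StepKernelBounds` at scale `k ≤ N`, `‖H‖_{k,0} ≤ ⅛`, and an admissible factorising `K`
(`K(∅) = 1`, `C^{r₀}`, local, `‖K‖_k^{(A)} ≤ C`): for DISJOINT `k`-polymers `Z, Y` and every `φ`,
`ξ ↦ e^{−H(Z, φ+ξ)} K(Y, φ+ξ)` is `μ_{k+1}`-integrable.
[cite: AdamsBuchholzKoteckyMuller2019, Lemma 8.4 / Proposition 6.6] -/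
theorem integrable_expNegH_mul_of_stepKernelBounds {L N Mord R n p r₀ : ℕ}
    {θbar lam μ δ₁ δ₀ A𝒫 A𝒫' C₂ h A : ℝ} {𝒞 : ℕ → (Fin d → ZMod M) → ℝ} {𝒞q : (Fin d → ZMod M) → ℝ}
    (hd : 2 ≤ d) (hLodd : Odd L) (hM : M = L ^ N) {k : ℕ} (hkN : k ≤ N) (hp : d / 2 + 1 ≤ p)
    (hMord : d / 2 + 1 ≤ Mord)
    (hB : AbkmWeightBounds L N Mord R n θbar lam μ δ₁ δ₀ A𝒫 𝒞
      (abkmWeightData L N Mord R θbar (schedDelta δ₀ δ₁ N) 𝒞))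
    (hS : StepKernelBounds (abkmWeightData L N Mord R θbar (schedDelta δ₀ δ₁ N) 𝒞) L k A𝒫' C₂ 𝒞q)
    (hδ₀ : 0 < δ₀) (hδ₁ : 0 < δ₁) (hh : 0 < h) (hh0 : hZeroSq d R δ₀ δ₁ ≤ h ^ 2) (hA : 0 < A)
    {H : RelevantHamiltonian ℂ d}
    (hH : hamNorm (fieldWt h (L : ℝ) d k) ((L : ℝ) ^ k) (L ^ (d * k)) H ≤ 1 / 8)
    {K : Finset (Fin d → ZMod M) → ((Fin d → ZMod M) → ℝ) → ℂ} {C : ℝ} (hC : 0 ≤ C)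
    (hK : WeakNormLE (abkmNormParams L N Mord R p r₀ h θbar A (schedDelta δ₀ δ₁ N) 𝒞) k K C)
    (hKfac : Factorises (L ^ k) K) (hK0 : ∀ φ, K ∅ φ = 1) (hKd : ∀ Y, ContDiff ℝ r₀ (K Y))
    (hKloc : ∀ Y, IsPolymer (L ^ k) Y → IsConn Y →
      IsGaugeLocal ((abkmNormParams L N Mord R p r₀ h θbar A (schedDelta δ₀ δ₁ N) 𝒞).gauge k Y) (K Y))
    {Z Y : Finset (Fin d → ZMod M)} (hZ : IsPolymer (L ^ k) Z) (hY : IsPolymer (L ^ k) Y)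
    (hZY : Disjoint Z Y) (φ : (Fin d → ZMod M) → ℝ) :
    Integrable (fun ξ => Complex.exp (-(eval H Z (φ + ξ))) * K Y (φ + ξ)) (stepMeasure 𝒞q) := by
  set P := abkmNormParams L N Mord R p r₀ h θbar A (schedDelta δ₀ δ₁ N) 𝒞 with hP
  have hL0 : (0 : ℝ) < L := by exact_mod_cast hLodd.pos
  have h𝔥 : 0 < P.𝔥 k := fieldWt_pos hh hL0 d k
  have hR : 0 < P.R k := by show (0 : ℝ) < (L : ℝ) ^ k; positivity
  have hb := tayNormLE_bprod_expNegH_mul_abkm (p := p) (r₀ := r₀) hd hLodd hM hkN hp hMord hB hδ₀ hδ₁ hh hh0 hA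
    hZ hY hZY hH hC hK hKfac hK0 hKd hKloc
  have hc : 0 ≤ (∏ _B ∈ blocks (L ^ k) Z, Real.exp (1 / 4)) *
      ∏ Y' ∈ components Y, C * P.aFactor k Y' :=
    mul_nonneg (Finset.prod_nonneg fun _ _ => (Real.exp_pos _).le)
      (Finset.prod_nonneg fun Y' _ => mul_nonneg hC (WeakNormLE.aFactor_pos hA k Y').le)
  have hFd : ContDiff ℝ r₀ (fun ψ => bprod (L ^ k) (fun B => expNegH H B ψ) Z * K Y ψ) := by
    refine ContDiff.mul ?_ (hKd Y)
    unfold TorusPolymer.bprod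
    exact contDiff_prod fun B _ => (contDiff_eval H B (n := r₀)).neg.cexp
  have hZX : Z ⊆ Z ∪ Y := Finset.subset_union_left
  have hYX : Y ⊆ Z ∪ Y := Finset.subset_union_right
  have hMo : Odd M := by rw [hM]; exact hLodd.pow
  obtain ⟨t, ht⟩ : ∃ t, N = k + t := ⟨N - k, by omega⟩
  have hMt : M = L ^ k * L ^ t := by rw [← pow_add, ← ht]; exact hM
  have hloc : IsGaugeLocal (P.gauge k (Z ∪ Y)) (fun ψ => bprod (L ^ k) (fun B => expNegH H B ψ) Z * K Y ψ) := by
    refine IsGaugeLocal.mul ?_ ?_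
    · unfold TorusPolymer.bprod
      refine IsGaugeLocal.prod _ fun B hB => ?_
      have hBX : B ⊆ Z ∪ Y := (hZ.subset_of_mem_blocks hB).trans hZX
      exact (isGaugeLocal_cexp_neg_eval h𝔥.ne' hR.ne' hp (TorusPolymer.subset_thicken _ _) H).of_norm_le
        fun ξ => norm_fieldGauge_mono_set _ _ _ (TorusPolymer.thicken_mono _ hBX) ξ
    · -- `K(Y) = ∏_{Y'∈𝒞(Y)} K(Y')`, each factor local for the gauge of `Y' ⊆ Y ⊆ Z ∪ Y`
      have hpoly : ∀ Y' ∈ components Y, IsPolymer (L ^ k) Y' := fun Y' hY' =>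
        (TorusPolymer.IsPolymer.of_mem_components hMo hLodd.pow hY hY').1
      have hsep := TorusPolymer.pairwise_separated_components hMt hLodd.pow hLodd.pow hY
      have hKeq : K Y = fun φ => ∏ Y' ∈ components Y, K Y' φ := by
        funext φ
        conv_lhs => rw [Literature.Barriers.CriticalPhenomena.LongRangePhi4.Polymer.eq_biUnion_components Y]
        exact eq_prod_of_factorises hKfac hK0 _ hpoly hsep φ
      rw [hKeq]
      refine IsGaugeLocal.prod _ fun Y' hY' => ?_
      obtain ⟨hYp, hYc⟩ := TorusPolymer.IsPolymer.of_mem_components hMo hLodd.pow hY hY'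
      have hY'X : Y' ⊆ Z ∪ Y := by
        refine subset_trans ?_ hYX
        rw [Literature.Barriers.CriticalPhenomena.LongRangePhi4.Polymer.eq_biUnion_components Y]
        exact Finset.subset_biUnion_of_mem id hY'
      exact (hKloc Y' hYp hYc).of_norm_le fun ξ => norm_fieldGauge_mono_set _ _ _ (TorusPolymer.thicken_mono _ hY'X) ξ
  have hint := integrable_comp_add_of_tayNormLE hb hc hFd hloc
    (hS.weightSectionDominated hB.dominated (Z ∪ Y) (P.gauge k (Z ∪ Y))) φ
  refine hint.congr (ae_of_all _ fun ξ => ?_)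
  simp only
  rw [bprod_cexp_neg_eval' H hZ]
  where
  /-- `bprod` of `expNegH` is `e^{−H(Z)}` (restating `bprod_cexp_neg_eval` through `expNegH`). -/
  bprod_cexp_neg_eval' (H : RelevantHamiltonian ℂ d) {Z : Finset (Fin d → ZMod M)} {s : ℕ}
      (hZ : IsPolymer s Z) (ψ : (Fin d → ZMod M) → ℝ) :
      bprod s (fun B => expNegH H B ψ) Z = Complex.exp (-(eval H Z ψ)) :=
    bprod_cexp_neg_eval H hZ ψ

end Literature.MathematicalPhysics.StatisticalMechanics.GradientRG

end
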